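import Summits.AtomisticToContinuum.Crystallization.Theorems.ChargedEnergyGapFarkasKernel
import HarnessLib

/-!
# ChargedEnergyGap · NODE 110C «BspKernel» — a generic binary space partition over 110B rows (door D5b, memo §10–§12)

decomp-a2c lens-3 g92 (generic; imports lane NODE 110B «FarkasKernel» only).

Door D5 closes a station polytope `P = {x | rows}` by COVERING it with finitely many regions on each of which a linear verdict is available (a
basis-feasibility cone `B⁻¹W ≥ 0` with its price functional, tree N105 `roofVal_T75_le_price`).  A flat list of cones does not evidently cover `P`;
a BINARY SPACE PARTITION does, by construction: an inner node splits on an affine form `a·x ≤ b` versus `(−a)·x ≤ −b` (one of the two holds at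
every real point), a leaf names a PAYLOAD `π` (e.g. which basis) and proves, by 110B Farkas certificates from the rows accumulated along its
branch, every row the payload NEEDS (`need π`, e.g. the six cone facets and the verdict `K·y_B·W ≤ capLB`).  Soundness is one induction on the tree:
`check = true` ⇒ every point of `P` admits some payload whose needed rows all hold.  What a payload's rows MEAN (cost ≤ cap) is supplied by the user
(door D5c «StationCert»); this file is pure list logic + `linarith`.

* `negCoeffs` + `linAt_negCoeffs`; `Bsp Pay` (leaf / split); `leafCheck`, `Bsp.check : (Pay → List LRow) → List LRow → Bsp Pay → Bool` (structural);
* ★★ `Bsp.sound : t.check need rows = true → (∀ r ∈ rows, linAt r.a x 0 ≤ r.b) → ∃ π, ∀ r ∈ need π, linAt r.a x 0 ≤ r.b`.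

Split rows are APPENDED (`rows ++ [⟨a, b⟩]`), so the base rows keep their indices in every leaf's sparse multipliers.

[SPLIT beneath (T¹ᶜ) (no EQUIV introduced) · generic kernel for D5 forms F and G · UNDECIDED(test = (D¹)) unchanged.] -/

namespace Summit.AtomisticToContinuum.Crystallization.Theorems.ChargedEnergyGapChartDial

/-! ## §110C.1 Negated rows -/
section Neg

/-- Coefficientwise negation of a coefficient list. -/
def negCoeffs : List ℚ → List ℚ
  | [] => []
  | c :: cs => (-c) :: negCoeffs cs

/-- `negCoeffs` negates the linear form. -/
theorem linAt_negCoeffs (a : List ℚ) (x : ℕ → ℝ) (i : ℕ) : linAt (negCoeffs a) x i = -linAt a x i := by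
  induction a generalizing i with
  | nil => simp [negCoeffs]
  | cons c cs ih => simp only [negCoeffs, linAt_cons, ih]; push_cast; ring

/-- At every real point one side of an affine split holds: `a·x ≤ b` or `(−a)·x ≤ −b`. -/
theorem split_dichotomy (a : List ℚ) (b : ℚ) (x : ℕ → ℝ) :
    linAt a x 0 ≤ (b : ℝ) ∨ linAt (negCoeffs a) x 0 ≤ ((-b : ℚ) : ℝ) := by
  by_cases h : linAt a x 0 ≤ (b : ℝ)
  · exact Or.inl h
  · right; rw [linAt_negCoeffs]; push_cast; linarith

end Neg

/-! ## §110C.2 The partition tree and its check -/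
section Tree

/-- A BINARY SPACE PARTITION certificate with payloads of type `Pay`: a `leaf` names its payload and one sparse multiplier list per needed row;
a `split` node carries the affine form `(a, b)` and the subtrees for `a·x ≤ b` and `(−a)·x ≤ −b`. -/
inductive Bsp (Pay : Type) where
  /-- leaf: payload + Farkas multipliers, one list per row of `need payload` -/
  | leaf (payload : Pay) (mus : List (List (ℕ × ℚ))) : Bsp Pay
  /-- split on `a·x ≤ b` (subtree `le`) versus `(−a)·x ≤ −b` (subtree `gt`) -/
  | split (a : List ℚ) (b : ℚ) (le gt : Bsp Pay) : Bsp Pay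

/-- Leaf check: the `k`-th multiplier list is a 110B certificate of the `k`-th needed row from `rows` (too few lists ⇒ `false`). -/
def leafCheck (rows : List LRow) : List LRow → List (List (ℕ × ℚ)) → Bool
  | [], _ => true
  | _ :: _, [] => false
  | t :: ts, m :: ms => (FarkasCert.mk rows m t).check && leafCheck rows ts ms

/-- Soundness of the leaf check: every needed row follows from the rows. -/
theorem leafCheck_sound (rows : List LRow) (x : ℕ → ℝ) (hrows : ∀ r ∈ rows, linAt r.a x 0 ≤ (r.b : ℝ)) :
    ∀ (ts : List LRow) (ms : List (List (ℕ × ℚ))), leafCheck rows ts ms = true → ∀ t ∈ ts, linAt t.a x 0 ≤ (t.b : ℝ)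
  | [], _, _ => by simp
  | _ :: _, [], h => by simp [leafCheck] at h
  | t :: ts, m :: ms, h => by
    simp only [leafCheck, Bool.and_eq_true] at h
    intro t' ht'
    rcases List.mem_cons.1 ht' with rfl | hmem
    · exact (FarkasCert.mk rows m t').sound h.1 x hrows
    · exact leafCheck_sound rows x hrows ts ms h.2 t' hmem

variable {Pay : Type}

/-- The tree check (structural recursion on the tree; split rows are appended to the row list). -/
def Bsp.check (need : Pay → List LRow) : List LRow → Bsp Pay → Bool
  | rows, .leaf π ms => leafCheck rows (need π) ms
  | rows, .split a b le gt => Bsp.check need (rows ++ [⟨a, b⟩]) le && Bsp.check need (rows ++ [⟨negCoeffs a, -b⟩]) gt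

/-- Extending a valid row list by one valid row. -/
theorem rows_append_holds {rows : List LRow} {x : ℕ → ℝ} (hrows : ∀ r ∈ rows, linAt r.a x 0 ≤ (r.b : ℝ)) {s : LRow}
    (hs : linAt s.a x 0 ≤ (s.b : ℝ)) : ∀ r ∈ rows ++ [s], linAt r.a x 0 ≤ (r.b : ℝ) := by
  intro r hr
  rcases List.mem_append.1 hr with h | h
  · exact hrows r h
  · rw [List.mem_singleton.1 h]; exact hs

/-- ★★ **BSP SOUNDNESS**: a checked partition tree assigns to every point satisfying the rows a payload all of whose needed rows hold there. -/
theorem Bsp.sound (need : Pay → List LRow) (x : ℕ → ℝ) :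
    ∀ (t : Bsp Pay) (rows : List LRow), t.check need rows = true → (∀ r ∈ rows, linAt r.a x 0 ≤ (r.b : ℝ)) →
      ∃ π, ∀ r ∈ need π, linAt r.a x 0 ≤ (r.b : ℝ)
  | .leaf π ms, rows, h, hrows => ⟨π, leafCheck_sound rows x hrows (need π) ms (by simpa [Bsp.check] using h)⟩
  | .split a b le gt, rows, h, hrows => by
    simp only [Bsp.check, Bool.and_eq_true] at h
    rcases split_dichotomy a b x with hx | hx
    · exact Bsp.sound need x le _ h.1 (rows_append_holds hrows (s := ⟨a, b⟩) hx)
    · exact Bsp.sound need x gt _ h.2 (rows_append_holds hrows (s := ⟨negCoeffs a, -b⟩) hx)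

/-- Corollary in the shape door D5c consumes: if every payload's needed rows IMPLY a common goal `G x`, a checked tree proves `G` on the polytope. -/
theorem Bsp.sound_goal (need : Pay → List LRow) {G : (ℕ → ℝ) → Prop}
    (hG : ∀ π x, (∀ r ∈ need π, linAt r.a x 0 ≤ (r.b : ℝ)) → G x) (t : Bsp Pay) (rows : List LRow) (h : t.check need rows = true)
    (x : ℕ → ℝ) (hrows : ∀ r ∈ rows, linAt r.a x 0 ≤ (r.b : ℝ)) : G x := by
  obtain ⟨π, hπ⟩ := t.sound need x rows h hrows
  exact hG π x hπ

end Tree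

end Summit.AtomisticToContinuum.Crystallization.Theorems.ChargedEnergyGapChartDial
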